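import Literature.MathematicalPhysics.KineticTheory.HardSphereHierarchyModel
import Literature.MathematicalPhysics.KineticTheory.HierarchyDuhamelSeriesOn
import HarnessLib

/-!
# The BBGKY side of BGSR Prop. 4.3 / Props. 5.4–5.5 under the CORRECTED robustness input (R')
(Bodineau–Gallagher–Saint-Raymond 2016 §4.4 Prop. 4.3, §5.3 Props. 5.4–5.5, pp. 13, 19–20;
trunk T-KINETIC, topic MathematicalPhysics/KineticTheory; the hard-sphere instance of the
correction layer `HierarchyDuhamelSeriesOn` of the bottom-up plan towards fact (c)
`bodineau_gallagher_saintRaymond_linear`.)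

`HardSphereHierarchyModel` reduced BGSR's Prop. 4.3 and Props. 5.4–5.5 for the tagged-particle
marginals `f_N^{(s)}` to two inputs on the hard-sphere dynamics: (S) the iterated Duhamel formula
up to null sets and (R) `HierarchyModel.RespectsAE (hsHierarchyModel …) (fun _ => volume)`. As
explained in `HierarchyDuhamelSeriesOn`, (R) quantifies over all nice families and is false for
the hard-sphere model (reads of the collision operator outside the hard-sphere domain); the
physically meaningful and provable input is
(R') `HierarchyModel.RespectsAEOn (hsHierarchyModel …) (fun _ => volume) (hard-sphere domains)`.
This file PROVES that the hard-sphere model preserves supports in the domains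
(`preservesSupport_hsHierarchyModel`) and re-threads the two reductions under (R'):

* `bgsrMarginal_ae_abs_sub_blockComp_le_on` — Prop. 4.3 (4.14) for `f_N^{(1)}` a.e. under (S), (R');
* `bgsrMarginal_ae_abs_sub_truncSepMain_le_on` — plus the energy-truncation and time-separation
  errors (Props. 5.4–5.5), under (S), (R').

## References

* T. Bodineau, I. Gallagher, L. Saint-Raymond, Invent. Math. 203 (2016), arXiv:1305.3397v2,
  §4.4 Prop. 4.3 (4.14) p. 13; §5.3 Props. 5.4–5.5 pp. 19–20.
-/

open MeasureTheory Metric Real Set Filter Function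
open scoped Nat InnerProductSpace
open Literature.Analysis.FluidPDE (Config configEnergy GCState duhamelTerm duhamelTerm_zero
  duhamelTerm_succ hardSphereDomain)

namespace Literature.MathematicalPhysics.KineticTheory

noncomputable section

section Kinetic

variable {d : Type*} [Fintype d]

section Marginals

local notation "𝕋" => UnitAddTorus d

attribute [local instance] sigmaFinite_volume_phaseSpace

variable {ε : ℝ} (hε : 0 < ε) (hε' : ε < 2⁻¹) (N : ℕ) (β : ℝ) (ρ₀ : UnitAddTorus d → ℝ)

include hε hε' in
/-- **The hard-sphere model preserves supports in the hard-sphere domains**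
(`duhamelTerm_hsHierarchyModel_eq_zero_of_not_mem`). [folklore] -/
theorem preservesSupport_hsHierarchyModel (M₀ : ℕ) :
    (hsHierarchyModel (d := d) hε hε' M₀).PreservesSupport
      (fun k => hardSphereDomain (Literature.Analysis.FluidPDE.Torus.geometry d) k ε) :=
  fun n s t _ hG Z hZ => duhamelTerm_hsHierarchyModel_eq_zero_of_not_mem hε hε' M₀ (fun k Z' hZ' => hG k Z' hZ') n s t Z hZ

/-- **BGSR Proposition 4.3 (4.14) for `f_N^{(1)}`, almost everywhere, from (S) and the corrected
input (R')** (`HierarchyModel.RespectsAEOn` on the hard-sphere domains): the statement of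
`bgsrMarginal_ae_abs_sub_blockComp_le` with (R') in place of (R); the marginals vanish off the
domains (`bgsrMarginalFamily_eq_zero_of_not_mem`) and the model preserves supports.
[cite: BodineauGallagherSaintRaymondInvent2016, §4.4 Prop. 4.3 (4.14), p. 13] -/
theorem bgsrMarginal_ae_abs_sub_blockComp_le_on (hβ : 0 < β) (hρ₀m : Measurable ρ₀) {R : ℝ}
    (hρ₀0 : ∀ x, 0 ≤ ρ₀ x) (hR : ∀ x, ρ₀ x ≤ R) (hN : (N : ℝ) * (2 * ε) ^ Fintype.card d ≤ 2⁻¹)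
    {T : ℝ}
    (hS : ∀ s ≤ N + 1, ∀ t ∈ Icc 0 T,
      (hsHierarchyModel (d := d) hε hε' (N + 1)).seriesFamily (N + 1)
          (fun k => bgsrMarginalFamily hε hε' N β ρ₀ k 0) s t =ᵐ[volume]
        bgsrMarginalFamily hε hε' N β ρ₀ s t)
    (hRob : (hsHierarchyModel (d := d) hε hε' (N + 1)).RespectsAEOn (fun _ => volume)
      (fun k => hardSphereDomain (Literature.Analysis.FluidPDE.Torus.geometry d) k ε))
    {A : ℕ} (hA : 2 ≤ A) {γ : ℝ} (hγ0 : 0 ≤ γ) (hγ : γ ≤ 1 / 2) {h : ℝ} (hh0 : 0 ≤ h)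
    (hsmall : max 1 (2 * maxwellianConst d β) * (hsHierarchyModel (d := d) hε hε' (N + 1)).pruneConst β * h ≤
      γ / exp 2)
    (K : ℕ) (hKT : K * h ≤ T) :
    ∀ᵐ Z : Config 1 d 𝕋, |bgsrMarginalFamily hε hε' N β ρ₀ 1 (K * h) Z -
        (hsHierarchyModel (d := d) hε hε' (N + 1)).blockComp (pruneSeq A) h K
          (fun a => bgsrMarginalFamily hε hε' N β ρ₀ a 0) 1 Z| ≤
      4 * γ ^ A * R * max 1 (2 * maxwellianConst d β) := by
  set M := hsHierarchyModel (d := d) hε hε' (N + 1) with hMdef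
  set P := bgsrMarginalFamily (d := d) hε hε' N β ρ₀ with hPdef
  set C₀ := max 1 (2 * maxwellianConst d β) with hC₀
  have hR0 : 0 ≤ R := (hρ₀0 0).trans (hR 0)
  have hC₀1 : 1 ≤ C₀ := le_max_left _ _
  -- the initial family: nice, vanishing above `N + 1` and off the domains
  have hf₀ : ∀ k, IsNice (P k 0) := fun k =>
    ⟨measurable_bgsrMarginalFamily hε hε' N β ρ₀ hρ₀m k 0, R * C₀ ^ k, β, hβ,
      abs_bgsrMarginalFamily_le hε hε' N β ρ₀ hβ hρ₀0 hR hN k 0⟩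
  have hvan : ∀ k, N + 1 < k → P k 0 = 0 := fun k hk => bgsrMarginalFamily_eq_zero_of_lt hε hε' N β ρ₀ hk 0
  have hf₀D : ∀ (k : ℕ) (Z : Config k d 𝕋), Z ∉ hardSphereDomain (Literature.Analysis.FluidPDE.Torus.geometry d) k ε →
      P k 0 Z = 0 := fun k Z hZ => bgsrMarginalFamily_eq_zero_of_not_mem hε hε' N β ρ₀ k 0 hZ
  -- block times lie in `[0, T]`
  have hti : ∀ i < K, K * h - (i + 1) * h ∈ Icc 0 T := by
    intro i hi
    have : (i + 1 : ℝ) ≤ K := by exact_mod_cast hi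
    refine ⟨by nlinarith, ?_⟩
    nlinarith [mul_nonneg (by positivity : (0 : ℝ) ≤ i + 1) hh0]
  -- the agreement at the block times, at every level (trivial above `N + 1`)
  have hS' : ∀ i < K, ∀ k, M.seriesFamily (N + 1) (fun k => P k 0) k (K * h - (i + 1) * h) =ᵐ[volume]
      P k (K * h - (i + 1) * h) := by
    intro i hi k
    rcases le_or_gt k (N + 1) with hk | hk
    · exact hS k hk _ (hti i hi)
    · refine Eventually.of_forall fun Z => ?_
      rw [HierarchyModel.seriesFamily_eq_zero_of_lt hvan hk, hPdef,
        bgsrMarginalFamily_eq_zero_of_lt hε hε' N β ρ₀ hk]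
      rfl
  have hmain := HierarchyModel.seriesFamily_ae_abs_sub_blockComp_le_on (M := M) (μ := fun _ => volume)
    (D := fun k => hardSphereDomain (Literature.Analysis.FluidPDE.Torus.geometry d) k ε)
    (hsHierarchyModel_flow_add hε hε' (N + 1)) hf₀ hvan hf₀D hRob (preservesSupport_hsHierarchyModel hε hε' (N + 1))
    (fun k τ _ => measurable_bgsrMarginalFamily hε hε' N β ρ₀ hρ₀m k τ)
    (fun k τ _ Z hZ => bgsrMarginalFamily_eq_zero_of_not_mem hε hε' N β ρ₀ k τ hZ) hR0 hC₀1 hβ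
    (fun k τ _ Z => abs_bgsrMarginalFamily_le hε hε' N β ρ₀ hβ hρ₀0 hR hN k τ Z)
    hA hγ0 hγ hh0 hsmall K hKT hS'
  -- replace `F^{(1)}(Kh)` by `f_N^{(1)}(Kh)` (hypothesis (S) at level `1`) and `F(0)` by `f_N(0)`
  have hK1 : M.seriesFamily (N + 1) (fun k => P k 0) 1 (K * h) =ᵐ[volume] P 1 (K * h) :=
    hS 1 (by omega) _ ⟨by positivity, hKT⟩
  have h0 : (fun a => M.seriesFamily (N + 1) (fun k => P k 0) a 0) = fun a => P a 0 :=
    funext fun a => seriesFamily_hsHierarchyModel_zero hε hε' (N + 1) (N + 1) _ a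
  filter_upwards [hmain, hK1] with Z hZ hZ1
  rw [h0, hZ1] at hZ
  exact hZ

/-- **BGSR Prop. 4.3 with Props. 5.4–5.5 for `f_N^{(1)}`, almost everywhere, from (S) and the
corrected input (R')**: the statement of `bgsrMarginal_ae_abs_sub_truncSepMain_le` with (R') in
place of (R). [cite: BodineauGallagherSaintRaymondInvent2016, §4.4 Prop. 4.3 and §5.3 Props. 5.4–5.5, pp. 13, 19–20] -/
theorem bgsrMarginal_ae_abs_sub_truncSepMain_le_on (hβ : 0 < β) (hρ₀m : Measurable ρ₀) {R : ℝ}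
    (hρ₀0 : ∀ x, 0 ≤ ρ₀ x) (hR : ∀ x, ρ₀ x ≤ R) (hN : (N : ℝ) * (2 * ε) ^ Fintype.card d ≤ 2⁻¹)
    {T : ℝ}
    (hS : ∀ s ≤ N + 1, ∀ t ∈ Icc 0 T,
      (hsHierarchyModel (d := d) hε hε' (N + 1)).seriesFamily (N + 1)
          (fun k => bgsrMarginalFamily hε hε' N β ρ₀ k 0) s t =ᵐ[volume]
        bgsrMarginalFamily hε hε' N β ρ₀ s t)
    (hRob : (hsHierarchyModel (d := d) hε hε' (N + 1)).RespectsAEOn (fun _ => volume)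
      (fun k => hardSphereDomain (Literature.Analysis.FluidPDE.Torus.geometry d) k ε))
    {A : ℕ} (hA : 2 ≤ A) {γ : ℝ} (hγ0 : 0 ≤ γ) (hγ : γ ≤ 1 / 2) {h : ℝ} (hh0 : 0 ≤ h)
    (hsmall : max 1 (2 * maxwellianConst d β) * (hsHierarchyModel (d := d) hε hε' (N + 1)).pruneConst β * h ≤
      γ / exp 2)
    (K : ℕ) (hKT : K * h ≤ T) (E : ℝ) {δ : ℝ} (hδ : 0 ≤ δ) :
    ∀ᵐ Z : Config 1 d 𝕋, |bgsrMarginalFamily hε hε' N β ρ₀ 1 (K * h) Z -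
        (hsHierarchyModel (d := d) hε hε' (N + 1)).sepBlockComp δ (pruneSeq A) h K
          (energyTruncate E fun a => bgsrMarginalFamily hε hε' N β ρ₀ a 0) 1 Z| ≤
      4 * γ ^ A * R * max 1 (2 * maxwellianConst d β) +
        R * exp (-(β * E ^ 2 / 4)) * max 1 (2 * maxwellianConst d β) *
          exp (6 * (max 1 (2 * maxwellianConst d β) *
            (hsHierarchyModel (d := d) hε hε' (N + 1)).pruneConst (β / 2) * h) * (A : ℝ) ^ K) +
        12 * R * max 1 (2 * maxwellianConst d β) *
          (max 1 (2 * maxwellianConst d β) * (hsHierarchyModel (d := d) hε hε' (N + 1)).pruneConst β * δ) *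
          (A : ℝ) ^ (2 * K) *
          exp (12 * (max 1 (2 * maxwellianConst d β) *
            (hsHierarchyModel (d := d) hε hε' (N + 1)).pruneConst β * h) * (A : ℝ) ^ K) := by
  set M := hsHierarchyModel (d := d) hε hε' (N + 1) with hMdef
  set G0 : GCState d 𝕋 := fun a => bgsrMarginalFamily (d := d) hε hε' N β ρ₀ a 0 with hG0
  have hR0 : 0 ≤ R := (hρ₀0 0).trans (hR 0)
  have hC' : 1 ≤ max 1 (2 * maxwellianConst d β) := le_max_left _ _
  have hnice : ∀ k, IsNice (G0 k) := fun k =>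
    ⟨measurable_bgsrMarginalFamily hε hε' N β ρ₀ hρ₀m k 0, R * (max 1 (2 * maxwellianConst d β)) ^ k, β, hβ,
      abs_bgsrMarginalFamily_le hε hε' N β ρ₀ hβ hρ₀0 hR hN k 0⟩
  have hlev : IsLevelBdd G0 (pruneLevel A K) R (max 1 (2 * maxwellianConst d β)) β :=
    isLevelBdd_bgsrMarginalFamily_zero hε hε' N β ρ₀ hβ hρ₀0 hR hN _
  have h1 := bgsrMarginal_ae_abs_sub_blockComp_le_on hε hε' N β ρ₀ hβ hρ₀m hρ₀0 hR hN hS hRob hA hγ0 hγ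
    hh0 hsmall K hKT
  filter_upwards [h1] with Z hZ
  have h2 := M.abs_blockComp_sub_energyTruncate_le hA hR0 hC' hβ hnice K hlev hh0 E Z
  have hlevE : IsLevelBdd (energyTruncate E G0) (pruneLevel A K) R (max 1 (2 * maxwellianConst d β)) β :=
    fun a ha Z' => (abs_energyTruncate_le E G0 a Z').trans (hlev a ha Z')
  have h3 := M.abs_blockComp_sub_sepBlockComp_le_of_budget hδ hA hR0 hC' hβ
    (fun k => (hnice k).energyTruncate E) K hlevE hh0 Z
  calc _ = |(bgsrMarginalFamily hε hε' N β ρ₀ 1 (K * h) Z - M.blockComp (pruneSeq A) h K G0 1 Z) +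
            (M.blockComp (pruneSeq A) h K G0 1 Z - M.blockComp (pruneSeq A) h K (energyTruncate E G0) 1 Z) +
            (M.blockComp (pruneSeq A) h K (energyTruncate E G0) 1 Z -
              M.sepBlockComp δ (pruneSeq A) h K (energyTruncate E G0) 1 Z)| := by
          congr 1; ring
    _ ≤ _ := (abs_add_three _ _ _)
    _ ≤ _ := add_le_add (add_le_add hZ h2) h3

end Marginals

end Kinetic

end

end Literature.MathematicalPhysics.KineticTheory
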